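import Mathlib
import Summits.NavierStokesRegularity.NavierStokesRegularity.Theorems.FilamentSkeletonRssClause13ModelPieceBandReflect
import Summits.NavierStokesRegularity.NavierStokesRegularity.Theorems.FilamentSkeletonRssClause13ModelPieceLow
import Summits.NavierStokesRegularity.NavierStokesRegularity.Theorems.FilamentSkeletonRssClause13ModelPieceFar
import Summits.NavierStokesRegularity.NavierStokesRegularity.Theorems.FilamentSkeletonRssClause13ModelPieceFarOperator
import Summits.NavierStokesRegularity.NavierStokesRegularity.Theorems.FilamentSkeletonRssClause13ModelDecomposition
import Summits.NavierStokesRegularity.NavierStokesRegularity.Theorems.FilamentSkeletonRssClause13ModelGluingAlgebra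
import Summits.NavierStokesRegularity.NavierStokesRegularity.Theorems.FilamentSkeletonRssClause13ModelGluingMono

/-!
# Clause 13-J/13-R, brick n3 — THE MODEL 13-J∘ IN `L²`: `N(Y) ≤ C_mod·N(𝓛Y)` for the full 1-D model operator on ball-supported variations

Route `FilamentSkeletonRss`, ∃-side clause 13 (`Clause13RNearStraightL` stmt-NavierStokesRegularity-23612; typing-agnostic); design
`filament-plan/DESIGN-28296-model-gluing-g16.md` + v2 addendum (task C6: gluing).  The model operator is
`𝓛Y = iG·((2/q)Y − K_q∗Y) − w·Y′ + β₁·Y + β₂·conj Y` (`K_q(s) = (2q−s²)(s²+q)^{-5/2}`; slip `w ∈ C²`, `w(c)=0`, `|w′| ≤ Λ`, `|w″| ≤ Λ₂`;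
`β₁` continuous, `‖β₁‖ ≤ b₁`, `L₁`-Lipschitz; `β₂ ∈ C¹`, `‖β₂‖ ≤ b₂`, `‖β₂′‖ ≤ L₂`; J-averaged growth `β₀ ≤ ½w′ + Re β₁`), acting on
`Y ∈ C¹_c` supported in the ball `[c−R, c+R]`.  `model_l2_estimate`: given a SIX-PIECE KERNEL SYSTEM — real kernels `k_S0, k_S1, a (even), b (odd),
k_M, k_N` with `k_N = k_S0 + k_S1 + 2a + k_M`, whose profiles sit respectively in `|x| ≤ x_s` (`x = z√q`, `x_s ≤ 1/10`), in
`{(2/q)𝔖 ≤ −κ_S1}`, in the one-sided band `{𝔖′ ≥ σ₀}`, in `{(2/q)𝔖 ≥ κ_M}`, with `k̂_N = 1` on `|x| < X` and the transition kernel `t·k_N′ + k_N`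
profiled in `{(2/q)𝔖 ≥ κ_M}` — and the SMALLNESS CONDITION `6(δ₁+δ₂+2δ₃+δ₅+δ₆) ≤ ½` on the explicit error coefficients of the five landed piece
estimates, one has `N(Y) ≤ 12(α₁+α₂+2α₃+α₅+α₆)·N(𝓛Y)` with explicit `α`'s (`N(f) = (∫‖f‖²)^{1/2}`).  The `α_s, δ_s` are exactly the common-shape
coefficients of `…Clause13ModelGluingAlgebra` (S0: `low_piece_shape`; S1/MID: `window_piece_shape`; BAND±: `band_piece_shape`; FAR: `far_piece_shape`
fed by `l2_modelOperator_far_le`, the window estimate of the transition piece, `l2_far_le`, `l2_weight_far_le`); the decomposition and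
`N(Y)² ≤ 6Σ∫‖P_s‖²` are `…Clause13ModelDecomposition`.  All kernel constants enter through UPPER BOUNDS on the `L¹` moments (hypotheses `∫|k| ≤ K` etc.; monotonicity
`…Clause13ModelGluingMono`), all abbreviations through defining equations, so the smallness condition is stated in closed form; the existence of such kernel systems for every
`0 < x_s ≤ 1/10`, `X ≥ 7/2` (Schwartz profiles) and the clause-level scaling `R_b ≤ R_b0`, `Γ ≥ Γ₀` under which the condition holds are separate files.
Lane ns-filament-19175-p1 g17; `--supports stmt-NavierStokesRegularity-23612 --as helper`.
HONEST FRAMING: an `L²` a-priori estimate for an explicit 1-D model operator attached to a HYPOTHETICAL filament skeleton on the NEGATIVE side of a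
MODEL route; nothing here bears on Navier–Stokes regularity or blow-up.
-/

noncomputable section

open MeasureTheory Real Complex Filter Set
open scoped ComplexConjugate Topology
open Summit.NavierStokesRegularity.NavierStokesRegularity.Theorems.AnalyticStripLiaSymbol (liaSym)

namespace Summit.NavierStokesRegularity.NavierStokesRegularity.Theorems.MatchedKernel
set_option linter.dupNamespace false

/-- **THE MODEL 13-J∘ IN `L²`.**  See the module docstring: under the six-piece kernel system hypotheses and the smallness condition
`6(δ₁+δ₂+δ₃+δ₃+δ₅+δ₆) ≤ ½`, every `Y ∈ C¹_c` supported in `[c−R, c+R]` satisfies `N(Y) ≤ 12(α₁+α₂+α₃+α₃+α₅+α₆)·N(𝓛Y)`. [folklore] -/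
theorem model_l2_estimate
    {q G R Λ Λ₂ b₁ b₂ L₁ L₂ β₀ c xs X κS1 κM σ₀ θ η : ℝ}
    (hq : 0 < q) (hG : 0 < G) (hR : 0 ≤ R) (hxs : 0 < xs) (hxs' : xs ≤ 1 / 10) (hX : 0 < X) (hκS1 : 0 < κS1) (hκM : 0 < κM)
    (hσ₀ : 0 < σ₀) (hθ : 0 < θ) (hη : 0 < η) (hβ₀ : 0 < β₀)
    -- the variation
    {Y : ℝ → ℂ} (hY : ContDiff ℝ 1 Y) (hYs : HasCompactSupport Y) (hYR : ∀ x, x ∉ Set.Icc (c - R) (c + R) → Y x = 0)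
    -- the slip and the multipliers
    {w : ℝ → ℝ} (hw : Differentiable ℝ w) (hw2 : Differentiable ℝ (deriv w)) (hΛ : ∀ t, |deriv w t| ≤ Λ)
    (hΛ₂ : ∀ t, |deriv (deriv w) t| ≤ Λ₂) (hwc : w c = 0)
    {β₁ β₂ β₂' : ℝ → ℂ} (hβ₁c : Continuous β₁) (hb₁ : ∀ τ, ‖β₁ τ‖ ≤ b₁) (hL₁ : ∀ x y, ‖β₁ y - β₁ x‖ ≤ L₁ * |y - x|)
    (hβ₂ : ∀ τ, HasDerivAt β₂ (β₂' τ) τ) (hβ₂'c : Continuous β₂') (hb₂ : ∀ τ, ‖β₂ τ‖ ≤ b₂) (hL₂ : ∀ τ, ‖β₂' τ‖ ≤ L₂)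
    (hgrowth : ∀ τ, β₀ ≤ 1 / 2 * deriv w τ + (β₁ τ).re)
    -- kernel S0 (profile in `|z|√q ≤ xs`)
    {kS0 kS0' : ℝ → ℝ} (hS0d : ∀ t, HasDerivAt kS0 (kS0' t) t) (hS0'c : Continuous kS0') (hS0i : Integrable kS0)
    (hS0'i : Integrable kS0') (hS01 : Integrable fun t => t * kS0 t) (hS0'1 : Integrable fun t => t * kS0' t) {MS0 : ℝ}
    (hS0M : ∀ t, |kS0 t| ≤ MS0) (hS0supp : ∀ z : ℝ, (∫ t : ℝ, ((kS0 t : ℝ) : ℂ) * cexp (I * z * t)) ≠ 0 → |z| * √q ≤ xs)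
    -- kernel S1 (profile where `(2/q)𝔖 ≤ −κS1`)
    {kS1 kS1' : ℝ → ℝ} (hS1d : ∀ t, HasDerivAt kS1 (kS1' t) t) (hS1'c : Continuous kS1') (hS1i : Integrable kS1)
    (hS1'i : Integrable kS1') (hS11 : Integrable fun t => t * kS1 t) (hS1'1 : Integrable fun t => t * kS1' t) {MS1 : ℝ}
    (hS1M : ∀ t, |kS1 t| ≤ MS1)
    (hS1sym : ∀ z : ℝ, (∫ t : ℝ, ((kS1 t : ℝ) : ℂ) * cexp (I * z * t)) ≠ 0 → 2 / q * liaSym (z * √q) ≤ -κS1)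
    -- band kernels `a` (even), `b` (odd), profile `χ_a + iχ_b` in `{σ₀ ≤ 𝔖′}`
    {a a' b b' : ℝ → ℝ} (had : ∀ t, HasDerivAt a (a' t) t) (ha'c : Continuous a') (hai : Integrable a) (ha'i : Integrable a')
    (ha1 : Integrable fun t => t * a t) (ha'1 : Integrable fun t => t * a' t) {Ma : ℝ} (haM : ∀ t, |a t| ≤ Ma)
    (hbd : ∀ t, HasDerivAt b (b' t) t) (hb'c : Continuous b') (hbi : Integrable b) (hb'i : Integrable b')
    (hb1 : Integrable fun t => t * b t) (hb'1 : Integrable fun t => t * b' t) {Mb : ℝ} (hbM : ∀ t, |b t| ≤ Mb)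
    (haev : ∀ t, a (-t) = a t) (hbodd : ∀ t, b (-t) = -b t)
    (hband : ∀ z : ℝ, (∫ t : ℝ, ((a t : ℝ) : ℂ) * cexp (I * z * t)) + I * (∫ t : ℝ, ((b t : ℝ) : ℂ) * cexp (I * z * t)) ≠ 0 →
      σ₀ ≤ deriv liaSym (z * √q))
    -- kernel MID (profile where `κM ≤ (2/q)𝔖`)
    {kM kM' : ℝ → ℝ} (hMd : ∀ t, HasDerivAt kM (kM' t) t) (hM'c : Continuous kM') (hMi : Integrable kM)
    (hM'i : Integrable kM') (hM1 : Integrable fun t => t * kM t) (hM'1 : Integrable fun t => t * kM' t) {MM : ℝ}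
    (hMM : ∀ t, |kM t| ≤ MM)
    (hMsym : ∀ z : ℝ, (∫ t : ℝ, ((kM t : ℝ) : ℂ) * cexp (I * z * t)) ≠ 0 → κM ≤ 2 / q * liaSym (z * √q))
    -- near kernel `kN = kS0 + kS1 + 2a + kM` (profile `= 1` on `|z|√q < X`) and its transition kernel `t·kN′ + kN` (profile where `κM ≤ (2/q)𝔖`)
    {kN kN' kN'' : ℝ → ℝ} (hNd : ∀ t, HasDerivAt kN (kN' t) t) (hN'd : ∀ t, HasDerivAt kN' (kN'' t) t) (hN''c : Continuous kN'')
    (hNi : Integrable kN) (hN'i : Integrable kN') (hN1 : Integrable fun t => t * kN t) (hN'1 : Integrable fun t => t * kN' t)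
    (hN'2 : Integrable fun t => t ^ 2 * kN' t) (hN''1 : Integrable fun t => t * kN'' t) (hN''2 : Integrable fun t => t ^ 2 * kN'' t)
    {MN MT : ℝ} (hNM : ∀ t, |kN t| ≤ MN) (hTM : ∀ t, |t * kN' t + kN t| ≤ MT)
    (hNfar : ∀ z : ℝ, (∫ t : ℝ, ((kN t : ℝ) : ℂ) * cexp (I * z * t)) ≠ 1 → X ≤ |z| * √q)
    (hTsym : ∀ z : ℝ, (∫ t : ℝ, (((t * kN' t + kN t : ℝ)) : ℂ) * cexp (I * z * t)) ≠ 0 → κM ≤ 2 / q * liaSym (z * √q))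
    (hsum : ∀ t, kN t = kS0 t + kS1 t + 2 * a t + kM t)
    -- upper bounds for the `L¹` moments
    {S0K S0K1 S0Kd1 S1K S1K1 S1Kd S1Kd1 Ka Ka1 Kad1 Kb Kb1 Kbd1 MK MK1 MKd MKd1 NK NK1 NKd2 TM TM1 TMd TMd1 : ℝ}
    (bS0K : ∫ t, |kS0 t| ≤ S0K) (bS0K1 : ∫ t, |t| * |kS0 t| ≤ S0K1) (bS0Kd1 : ∫ t, |t| * |kS0' t| ≤ S0Kd1)
    (bS1K : ∫ t, |kS1 t| ≤ S1K) (bS1K1 : ∫ t, |t| * |kS1 t| ≤ S1K1) (bS1Kd : ∫ t, |kS1' t| ≤ S1Kd) (bS1Kd1 : ∫ t, |t| * |kS1' t| ≤ S1Kd1)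
    (bKa : ∫ t, |a t| ≤ Ka) (bKa1 : ∫ t, |t| * |a t| ≤ Ka1) (bKad1 : ∫ t, |t| * |a' t| ≤ Kad1)
    (bKb : ∫ t, |b t| ≤ Kb) (bKb1 : ∫ t, |t| * |b t| ≤ Kb1) (bKbd1 : ∫ t, |t| * |b' t| ≤ Kbd1)
    (bMK : ∫ t, |kM t| ≤ MK) (bMK1 : ∫ t, |t| * |kM t| ≤ MK1) (bMKd : ∫ t, |kM' t| ≤ MKd) (bMKd1 : ∫ t, |t| * |kM' t| ≤ MKd1)
    (bNK : ∫ t, |kN t| ≤ NK) (bNK1 : ∫ t, |t| * |kN t| ≤ NK1) (bNKd2 : ∫ t, t ^ 2 * |kN' t| ≤ NKd2)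
    (bTM : ∫ t, |t * kN' t + kN t| ≤ TM) (bTM1 : ∫ t, |t| * |t * kN' t + kN t| ≤ TM1) (bTMd : ∫ t, |2 * kN' t + t * kN'' t| ≤ TMd)
    (bTMd1 : ∫ t, |t| * |2 * kN' t + t * kN'' t| ≤ TMd1)
    -- abbreviations
    {gS0 ε ℓ cH CF RW αT δT α₁ α₂ α₃ α₅ α₆ δ₁ δ₂ δ₃ δ₅ δ₆ : ℝ}
    (egS0 : gS0 = G * (1 / 2 * Real.log (1 / xs))) (eε : ε = b₂ * q / (4 * G)) (hε1 : ε < 1) (eℓ : ℓ = L₂ * q / (4 * G))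
    (ecH : cH = (1 + ε) * G * (2 / q * (5 * Real.exp (-(X / 2)))) + 2 * b₁ * ε + 2 * (2 * G / q) * ε ^ 2)
    (eCF : CF = Λ₂ * (NKd2 + NK1) + (L₁ + L₂) * NK1) (eRW : RW = R + Real.sqrt 2 * (NK * R + NK1)) (eαT : αT = TM ^ 2 / (G * κM))
    (eδT : δT = ((Λ * (TMd1 + TM) + (L₁ + L₂) * TM1 + (b₁ + b₂) * TM + Real.sqrt 2 * Λ * TMd1) + Real.sqrt 2 * Λ * TMd * R) * TM / (G * κM))
    (eα₁ : α₁ = q / θ ^ 2 * (2 / gS0) * S0K ^ 2)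
    (eδ₁ : δ₁ = θ / (Real.pi * √q) * S0K ^ 2 * (2 * R)
      + q / θ ^ 2 * (2 / gS0 * ((Λ * (S0Kd1 + S0K) + (L₁ + L₂) * S0K1) * S0K + (b₁ + b₂) * S0K ^ 2) + Λ ^ 2 / gS0 ^ 2 * (2 * (S0K * R + S0K1) ^ 2)))
    (eα₂ : α₂ = S1K ^ 2 / (G * κS1))
    (eδ₂ : δ₂ = ((Λ * (S1Kd1 + S1K) + (L₁ + L₂) * S1K1 + (b₁ + b₂) * S1K + Real.sqrt 2 * Λ * S1Kd1) + Real.sqrt 2 * Λ * S1Kd * R) * S1K / (G * κS1))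
    (eα₃ : α₃ = √q * (Real.sqrt 2 * ((Ka + Kb) * R + (Ka1 + Kb1))) * (Ka + Kb) / (G * σ₀))
    (eδ₃ : δ₃ = √q * (Real.sqrt 2 * ((Ka + Kb) * R + (Ka1 + Kb1)))
      * (Λ * ((Kad1 + Kbd1) + (Ka + Kb)) + (L₁ + L₂) * (Ka1 + Kb1) + (Λ + b₁ + 3 * b₂) * (Ka + Kb)) / (G * σ₀))
    (eα₅ : α₅ = MK ^ 2 / (G * κM))
    (eδ₅ : δ₅ = ((Λ * (MKd1 + MK) + (L₁ + L₂) * MK1 + (b₁ + b₂) * MK + Real.sqrt 2 * Λ * MKd1) + Real.sqrt 2 * Λ * MKd * R) * MK / (G * κM))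
    (eα₆ : α₆ = (1 + ε) ^ 2 * (1 + NK) * ((1 + NK) + Λ * αT / (2 * η)) / (β₀ * (1 - ε) ^ 2))
    (eδ₆ : δ₆ = ((1 + ε) ^ 2 * (1 + NK) * Λ * (δT / (2 * η) + η / 2) + (1 + ε) * (1 + NK) * ((1 + ε) * CF + cH * (1 + NK) + ℓ * Λ * RW))
      / (β₀ * (1 - ε) ^ 2))
    -- THE SMALLNESS CONDITION
    (hδ : 6 * (δ₁ + δ₂ + δ₃ + δ₃ + δ₅ + δ₆) ≤ 1 / 2) :
    (∫ y : ℝ, ‖Y y‖ ^ 2) ^ (1 / 2 : ℝ)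
      ≤ 12 * (α₁ + α₂ + α₃ + α₃ + α₅ + α₆) * (∫ y : ℝ, ‖I * (G : ℂ) * ((2 / q : ℂ) * Y y
              - ∫ σ : ℝ, ((((2 * q - (y - σ) ^ 2) * (((y - σ) ^ 2 + q) ^ (5 / 2 : ℝ))⁻¹ : ℝ)) : ℂ) * Y σ)
            - ((w y : ℝ) : ℂ) * deriv Y y + β₁ y * Y y + β₂ y * conj (Y y)‖ ^ 2) ^ (1 / 2 : ℝ) := by
  /- §1 basic facts -/
  have hYc : Continuous Y := hY.continuous
  have hY2 : MemLp Y 2 volume := hYc.memLp_of_hasCompactSupport hYs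
  have hβ₂c : Continuous β₂ := continuous_iff_continuousAt.2 fun t => (hβ₂ t).continuousAt
  have hL₂lip : ∀ x y, ‖β₂ y - β₂ x‖ ≤ L₂ * |y - x| := by
    intro x y
    have h := Convex.norm_image_sub_le_of_norm_hasDerivWithin_le (f := β₂) (f' := β₂') (s := Set.univ)
      (fun t _ => (hβ₂ t).hasDerivWithinAt) (fun t _ => hL₂ t) convex_univ (Set.mem_univ x) (Set.mem_univ y)
    rwa [Real.norm_eq_abs] at h
  have hΛ0 : 0 ≤ Λ := (abs_nonneg _).trans (hΛ 0)
  have hΛ20 : 0 ≤ Λ₂ := (abs_nonneg _).trans (hΛ₂ 0)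
  have hb10 : 0 ≤ b₁ := (norm_nonneg _).trans (hb₁ 0)
  have hb20 : 0 ≤ b₂ := (norm_nonneg _).trans (hb₂ 0)
  have hL10 : 0 ≤ L₁ := by
    have := hL₁ 0 1; rw [sub_zero, abs_one, mul_one] at this; exact (norm_nonneg _).trans this
  have hL20 : 0 ≤ L₂ := (norm_nonneg _).trans (hL₂ 0)
  have hS0c : Continuous kS0 := continuous_iff_continuousAt.2 fun t => (hS0d t).continuousAt
  have hS1c : Continuous kS1 := continuous_iff_continuousAt.2 fun t => (hS1d t).continuousAt
  have hac : Continuous a := continuous_iff_continuousAt.2 fun t => (had t).continuousAt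
  have hbc : Continuous b := continuous_iff_continuousAt.2 fun t => (hbd t).continuousAt
  have hMc : Continuous kM := continuous_iff_continuousAt.2 fun t => (hMd t).continuousAt
  have hNc : Continuous kN := continuous_iff_continuousAt.2 fun t => (hNd t).continuousAt
  have hN'c : Continuous kN' := continuous_iff_continuousAt.2 fun t => (hN'd t).continuousAt
  have hlog : 0 < Real.log (1 / xs) := Real.log_pos (by rw [lt_div_iff₀ hxs]; linarith only [hxs'])
  /- §1b scalar facts over the named constants (all before the large hypotheses enter the context) -/
  have hK0 : ∀ k : ℝ → ℝ, 0 ≤ ∫ t, |k t| := fun k => integral_nonneg fun t => abs_nonneg _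
  have hK10 : ∀ k : ℝ → ℝ, 0 ≤ ∫ t, |t| * |k t| := fun k => integral_nonneg fun t => mul_nonneg (abs_nonneg _) (abs_nonneg _)
  have hK20 : ∀ k : ℝ → ℝ, 0 ≤ ∫ t, t ^ 2 * |k t| := fun k => integral_nonneg fun t => mul_nonneg (sq_nonneg _) (abs_nonneg _)
  have hS0K0 : 0 ≤ S0K := (hK0 kS0).trans bS0K
  have hS0K10 : 0 ≤ S0K1 := (hK10 kS0).trans bS0K1
  have hS0Kd10 : 0 ≤ S0Kd1 := (hK10 kS0').trans bS0Kd1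
  have hS1K0 : 0 ≤ S1K := (hK0 kS1).trans bS1K
  have hS1K10 : 0 ≤ S1K1 := (hK10 kS1).trans bS1K1
  have hS1Kd0 : 0 ≤ S1Kd := (hK0 kS1').trans bS1Kd
  have hS1Kd10 : 0 ≤ S1Kd1 := (hK10 kS1').trans bS1Kd1
  have hKa0 : 0 ≤ Ka := (hK0 a).trans bKa
  have hKa10 : 0 ≤ Ka1 := (hK10 a).trans bKa1
  have hKad10 : 0 ≤ Kad1 := (hK10 a').trans bKad1
  have hKb0 : 0 ≤ Kb := (hK0 b).trans bKb
  have hKb10 : 0 ≤ Kb1 := (hK10 b).trans bKb1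
  have hKbd10 : 0 ≤ Kbd1 := (hK10 b').trans bKbd1
  have hMK0 : 0 ≤ MK := (hK0 kM).trans bMK
  have hMK10 : 0 ≤ MK1 := (hK10 kM).trans bMK1
  have hMKd0 : 0 ≤ MKd := (hK0 kM').trans bMKd
  have hMKd10 : 0 ≤ MKd1 := (hK10 kM').trans bMKd1
  have hNK0 : 0 ≤ NK := (hK0 kN).trans bNK
  have hNK10 : 0 ≤ NK1 := (hK10 kN).trans bNK1
  have hNKd20 : 0 ≤ NKd2 := (hK20 kN').trans bNKd2
  have hTM0 : 0 ≤ TM := (hK0 (fun t => t * kN' t + kN t)).trans bTM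
  have hTM10 : 0 ≤ TM1 := (hK10 (fun t => t * kN' t + kN t)).trans bTM1
  have hTMd0 : 0 ≤ TMd := (hK0 (fun t => 2 * kN' t + t * kN'' t)).trans bTMd
  have hTMd10 : 0 ≤ TMd1 := (hK10 (fun t => 2 * kN' t + t * kN'' t)).trans bTMd1
  have hg : 0 < gS0 := by rw [egS0]; exact mul_pos hG (mul_pos one_half_pos hlog)
  have hε0 : 0 ≤ ε := by rw [eε]; positivity
  have hℓ0 : 0 ≤ ℓ := by rw [eℓ]; positivity
  have hcH0 : 0 ≤ cH := by rw [ecH]; positivity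
  have hCF0 : 0 ≤ CF := by rw [eCF]; positivity
  have hRW0 : 0 ≤ RW := by rw [eRW]; positivity
  have hαT0 : 0 ≤ αT := by rw [eαT]; positivity
  have hCB : 0 ≤ Λ * ((Kad1 + Kbd1) + (Ka + Kb)) + (L₁ + L₂) * (Ka1 + Kb1) + (Λ + b₁ + 3 * b₂) * (Ka + Kb) := by positivity
  have h1e : 0 < 1 - ε := by linarith only [hε1]
  have hα : 0 ≤ α₁ + α₂ + α₃ + α₃ + α₅ + α₆ := by
    have h₁ : 0 ≤ α₁ := by rw [eα₁]; positivity
    have h₂ : 0 ≤ α₂ := by rw [eα₂]; positivity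
    have h₃ : 0 ≤ α₃ := by rw [eα₃]; positivity
    have h₅ : 0 ≤ α₅ := by rw [eα₅]; positivity
    have h₆ : 0 ≤ α₆ := by rw [eα₆]; positivity
    linarith only [h₁, h₂, h₃, h₅, h₆]
  -- atoms with large integrands (no `positivity` on scalar goals after this point)
  have hsq0 : ∀ f : ℝ → ℂ, 0 ≤ (∫ x : ℝ, ‖f x‖ ^ 2) ^ (1 / 2 : ℝ) := fun f => Real.rpow_nonneg (integral_nonneg fun y => sq_nonneg _) _
  have hnY0 := hsq0 Y
  have hnL0 := hsq0 (fun y : ℝ => I * (G : ℂ) * ((2 / q : ℂ) * Y y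
              - ∫ σ : ℝ, ((((2 * q - (y - σ) ^ 2) * (((y - σ) ^ 2 + q) ^ (5 / 2 : ℝ))⁻¹ : ℝ)) : ℂ) * Y σ)
            - ((w y : ℝ) : ℂ) * deriv Y y + β₁ y * Y y + β₂ y * conj (Y y))
  have hnW0 := hsq0 (fun x : ℝ => (((x - c : ℝ) : ℂ)) * Y x)
  have hI0 : 0 ≤ ∫ x : ℝ, ‖Y x‖ := integral_nonneg fun x => norm_nonneg _
  have hnH0 := hsq0 (fun x : ℝ => (Y x - ∫ y : ℝ, ((kN (x - y) : ℝ) : ℂ) * Y y))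
  have hnT0 := hsq0 (fun x : ℝ => ∫ y : ℝ, (((x - y) * kN' (x - y) + kN (x - y) : ℝ) : ℂ) * Y y)
  /- §2 ball facts -/
  have hW := l2_weight_le_of_support hY2 hR hYR
  have hI := integral_norm_le_sqrt_mul_of_support hY2 hR hYR
  /- §3 the five piece estimates, with the named constants -/
  have h1 := model_piece_low_estimate hq hG hxs hxs' hθ hS0d hS0'c hS0i hS0'i hS01 hS0'1 hS0M
    (χ := fun z : ℝ => ∫ t : ℝ, ((kS0 t : ℝ) : ℂ) * cexp (I * z * t)) (fun z => rfl) hS0supp hY hYs c hw hΛ hwc hβ₁c hβ₂c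
    hb₁ hb₂ hL₁ hL₂lip
  rw [← egS0] at h1
  have h2 := model_piece_window_estimate hq hG hS1d hS1'c hS1i hS1'i hS11 hS1'1 hS1M
    (χ := fun z : ℝ => ∫ t : ℝ, ((kS1 t : ℝ) : ℂ) * cexp (I * z * t)) (fun z => rfl) (Or.inl hS1sym) hY hYs c hw hΛ hwc hβ₁c hβ₂c
    hb₁ hb₂ hL₁ hL₂lip
  have h3 := model_piece_band_estimate hq hG had ha'c hai ha'i ha1 ha'1 haM hbd hb'c hbi hb'i hb1 hb'1 hbM
    (χa := fun z : ℝ => ∫ t : ℝ, ((a t : ℝ) : ℂ) * cexp (I * z * t)) (χb := fun z : ℝ => ∫ t : ℝ, ((b t : ℝ) : ℂ) * cexp (I * z * t))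
    (fun z => rfl) (fun z => rfl) hband hY hYs c hw hΛ hwc hβ₁c hβ₂c hb₁ hb₂ hL₁ hL₂lip
  have h4 := model_piece_band_estimate_reflected hq hG had ha'c hai ha'i ha1 ha'1 haM hbd hb'c hbi hb'i hb1 hb'1 hbM haev hbodd
    (χa := fun z : ℝ => ∫ t : ℝ, ((a t : ℝ) : ℂ) * cexp (I * z * t)) (χb := fun z : ℝ => ∫ t : ℝ, ((b t : ℝ) : ℂ) * cexp (I * z * t))
    (fun z => rfl) (fun z => rfl) hband hY hYs c hw hΛ hwc hβ₁c hβ₂c hb₁ hb₂ hL₁ hL₂lip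
  have h5 := model_piece_window_estimate hq hG hMd hM'c hMi hM'i hM1 hM'1 hMM
    (χ := fun z : ℝ => ∫ t : ℝ, ((kM t : ℝ) : ℂ) * cexp (I * z * t)) (fun z => rfl) (Or.inr hMsym) hY hYs c hw hΛ hwc hβ₁c hβ₂c
    hb₁ hb₂ hL₁ hL₂lip
  /- §4 the far piece: energy estimate, operator bound, transition piece -/
  have h6 := model_piece_far_estimate hq hG hX hβ₀.le hNc hNi hN1 hNM
    (χ := fun z : ℝ => ∫ t : ℝ, ((kN t : ℝ) : ℂ) * cexp (I * z * t)) (fun z => rfl) hNfar hY hYs c hw hΛ hwc hβ₁c hβ₂ hβ₂'c hb₁ hb₂ hL₂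
    (by rw [← eε]; exact hε1.le) hgrowth
  rw [← eε, ← eℓ] at h6
  rw [← ecH] at h6
  have h6op := l2_modelOperator_far_le (G := G) hq hNd hN'c hNi hN1 hN'1 hN'2 hNM hY hYs hw hw2 hΛ hΛ₂ hβ₁c hβ₂c hb₁ hb₂ hL₁ hL₂lip
  have hmd : ∀ t, HasDerivAt (fun t : ℝ => t * kN' t + kN t) (2 * kN' t + t * kN'' t) t := fun t =>
    (((hasDerivAt_id t).mul (hN'd t)).add (hNd t)).congr_deriv (by simp only [id]; ring)
  have hm'c : Continuous fun t : ℝ => 2 * kN' t + t * kN'' t := (continuous_const.mul hN'c).add (continuous_id.mul hN''c)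
  have hmi : Integrable fun t : ℝ => t * kN' t + kN t := hN'1.add hNi
  have hm'i : Integrable fun t : ℝ => 2 * kN' t + t * kN'' t := (hN'i.const_mul 2).add hN''1
  have hm1 : Integrable fun t : ℝ => t * (t * kN' t + kN t) :=
    (hN'2.add hN1).congr (ae_of_all _ fun t => by simp only [Pi.add_apply]; ring)
  have hm'1 : Integrable fun t : ℝ => t * (2 * kN' t + t * kN'' t) :=
    ((hN'1.const_mul 2).add hN''2).congr (ae_of_all _ fun t => by simp only [Pi.add_apply]; ring)
  have hT := model_piece_window_estimate (k := fun t : ℝ => t * kN' t + kN t) (k' := fun t : ℝ => 2 * kN' t + t * kN'' t) hq hG hmd hm'c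
    hmi hm'i hm1 hm'1 hTM (χ := fun z : ℝ => ∫ t : ℝ, (((t * kN' t + kN t : ℝ)) : ℂ) * cexp (I * z * t)) (fun z => rfl) (Or.inr hTsym)
    hY hYs c hw hΛ hwc hβ₁c hβ₂c hb₁ hb₂ hL₁ hL₂lip
  beta_reduce at hT
  have hH := l2_far_le hNc hNi hYc hYs
  have hWH := l2_weight_far_le hNc hNi hN1 hYc hYs hR hYR
  /- §5 `L²` membership of the six pieces and the decomposition -/
  have hP1 : MemLp (fun x : ℝ => ∫ y : ℝ, ((kS0 (x - y) : ℝ) : ℂ) * Y y) 2 volume := memLp_piece hS0c hS0i hYc hYs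
  have hP2 : MemLp (fun x : ℝ => ∫ y : ℝ, ((kS1 (x - y) : ℝ) : ℂ) * Y y) 2 volume := memLp_piece hS1c hS1i hYc hYs
  have hPa : MemLp (fun x : ℝ => ∫ y : ℝ, ((a (x - y) : ℝ) : ℂ) * Y y) 2 volume := memLp_piece hac hai hYc hYs
  have hPb : MemLp (fun x : ℝ => ∫ y : ℝ, ((b (x - y) : ℝ) : ℂ) * Y y) 2 volume := memLp_piece hbc hbi hYc hYs
  have hP3 : MemLp (fun x : ℝ => (∫ y : ℝ, ((a (x - y) : ℝ) : ℂ) * Y y) + I * ∫ y : ℝ, ((b (x - y) : ℝ) : ℂ) * Y y) 2 volume :=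
    hPa.add (hPb.const_mul I)
  have hP4 : MemLp (fun x : ℝ => (∫ y : ℝ, ((a (x - y) : ℝ) : ℂ) * Y y) - I * ∫ y : ℝ, ((b (x - y) : ℝ) : ℂ) * Y y) 2 volume :=
    hPa.sub (hPb.const_mul I)
  have hP5 : MemLp (fun x : ℝ => ∫ y : ℝ, ((kM (x - y) : ℝ) : ℂ) * Y y) 2 volume := memLp_piece hMc hMi hYc hYs
  have hP6 : MemLp (fun x : ℝ => Y x - ∫ y : ℝ, ((kN (x - y) : ℝ) : ℂ) * Y y) 2 volume := hY2.sub (memLp_piece hNc hNi hYc hYs)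
  have hsum6 := sq_l2_le_six_sum (model_decomposition hS0c hS1c hac hMc b hsum hYc hYs) hP1 hP2 hP3 hP4 hP5 hP6
  /- §6 common shapes (raw moments), monotonicity (named bounds), absorption -/
  have hCS0 : 0 ≤ Λ * ((∫ t, |t| * |kS0' t|) + ∫ t, |kS0 t|) + (L₁ + L₂) * ∫ t, |t| * |kS0 t| :=
    add_nonneg (mul_nonneg hΛ0 (add_nonneg (hK10 _) (hK0 _))) (mul_nonneg (add_nonneg hL10 hL20) (hK10 _))
  have s1 := (low_piece_shape hq hθ hg (hK0 kS0) (hK10 kS0) hR hnY0 (l2_sq_eq Y).symm hI0 hI hnW0 hW h1).trans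
    (low_shape_mono (Λ := Λ) hq hθ hg hb10 hb20 hR hnL0 hnY0 (hK0 kS0) (hK10 kS0) hCS0 bS0K bS0K1 (lowC_mono hΛ0 hL10 hL20 bS0K bS0K1 bS0Kd1))
  rw [← eα₁, ← eδ₁] at s1
  have s2 := (window_piece_shape hG hκS1 (hK0 kS1) (hK0 kS1') hΛ0 hnY0 hW h2).trans
    (window_shape_mono hG hκS1 hΛ0 hL10 hL20 hb10 hb20 hR hnL0 hnY0 (hK0 kS1) (hK10 kS1) (hK0 kS1') (hK10 kS1') bS1K bS1K1 bS1Kd bS1Kd1)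
  rw [← eα₂, ← eδ₂] at s2
  have hCBraw : 0 ≤ Λ * (((∫ t, |t| * |a' t|) + (∫ t, |t| * |b' t|)) + ((∫ t, |a t|) + (∫ t, |b t|)))
      + (L₁ + L₂) * ((∫ t, |t| * |a t|) + (∫ t, |t| * |b t|)) + (Λ + b₁ + 3 * b₂) * ((∫ t, |a t|) + (∫ t, |b t|)) :=
    add_nonneg (add_nonneg (mul_nonneg hΛ0 (add_nonneg (add_nonneg (hK10 _) (hK10 _)) (add_nonneg (hK0 _) (hK0 _))))
      (mul_nonneg (add_nonneg hL10 hL20) (add_nonneg (hK10 _) (hK10 _))))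
      (mul_nonneg (by linarith only [hΛ0, hb10, hb20]) (add_nonneg (hK0 _) (hK0 _)))
  have hbandC := bandC_mono hΛ0 hL10 hL20 hb10 hb20 bKa bKb bKa1 bKb1 bKad1 bKbd1
  have s3 := (band_piece_shape hG hσ₀ hq (add_nonneg (hK0 a) (hK0 b)) hCBraw hnY0 hnL0 hW h3).trans
    (band_shape_mono hG hσ₀ hR hnL0 hnY0 (add_nonneg (hK0 a) (hK0 b)) (add_nonneg (hK10 a) (hK10 b)) hCBraw (add_le_add bKa bKb)
      (add_le_add bKa1 bKb1) hbandC)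
  rw [← eα₃, ← eδ₃] at s3
  have s4 := (band_piece_shape hG hσ₀ hq (add_nonneg (hK0 a) (hK0 b)) hCBraw hnY0 hnL0 hW h4).trans
    (band_shape_mono hG hσ₀ hR hnL0 hnY0 (add_nonneg (hK0 a) (hK0 b)) (add_nonneg (hK10 a) (hK10 b)) hCBraw (add_le_add bKa bKb)
      (add_le_add bKa1 bKb1) hbandC)
  rw [← eα₃, ← eδ₃] at s4
  have s5 := (window_piece_shape hG hκM (hK0 kM) (hK0 kM') hΛ0 hnY0 hW h5).trans
    (window_shape_mono hG hκM hΛ0 hL10 hL20 hb10 hb20 hR hnL0 hnY0 (hK0 kM) (hK10 kM) (hK0 kM') (hK10 kM') bMK bMK1 bMKd bMKd1)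
  rw [← eα₅, ← eδ₅] at s5
  have sT := (window_piece_shape hG hκM (hK0 _) (hK0 _) hΛ0 hnY0 hW hT).trans
    (window_shape_mono hG hκM hΛ0 hL10 hL20 hb10 hb20 hR hnL0 hnY0 (hK0 _) (hK10 _) (hK0 _) (hK10 _) bTM bTM1 bTMd bTMd1)
  rw [← eαT, ← eδT] at sT
  obtain ⟨hH', hWH', hLH'⟩ := far_atoms_mono hnY0 hnL0 bNK (farRW_mono hR bNK bNK1) (farCF_mono hΛ20 hL10 hL20 bNK1 bNKd2) hH hWH h6op
  rw [← eRW] at hWH'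
  rw [← eCF] at hLH'
  have hTsq := l2_sq_eq (fun x : ℝ => ∫ y : ℝ, (((x - y) * kN' (x - y) + kN (x - y) : ℝ) : ℂ) * Y y)
  have s6 := far_piece_shape hβ₀ hε0 hε1 hNK0 hΛ0 hℓ0 hcH0 hCF0 hRW0 hη hnY0 hnL0 hnH0 hnT0 hH' hWH' hLH' hTsq sT h6
  rw [← eα₆, ← eδ₆] at s6
  exact glue_absorb hnY0 hnL0 hsum6 s1 s2 s3 s4 s5 s6 hα hδ

end Summit.NavierStokesRegularity.NavierStokesRegularity.Theorems.MatchedKernel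

end
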